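import Summits.NavierStokesRegularity.FluidComputer.GateBudgetLadderSharp
import Summits.NavierStokesRegularity.FluidComputer.GateBudgetDudHorizonClock
import HarnessLib

/-!
# GateBudget part 89 — the sharp dud horizon: numerics, the misfire ladder, the explicit horizon
# (§258–§259)

Cell `pub-fluidc`, blueprint seat bp1 (gen 37, successor item (a) of SPEC-INPUT-bp1 §BO(4));
namespace `Summit.NavierStokesRegularity.FluidComputer.GateBudget`, headline member
`RotorKnob.rotorCircuit K K¹⁰ ε ρ` of the two-scale family from `delayInit` (5.6), `K ≥ 16`, on
the lattice window `200ε/K²⁰ ≤ ρ² ≤ 2ε/K¹⁰`, `ε² ≤ 1/(6K²⁰)`, `ε = kK¹⁰ρ²`; modes `0 = a`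
(carrier), `1 = b` (clock), `2 = c` (trigger), `3 = d` (transfer), `4 = ã` (output).
HONEST FRAMING: a low prior, high value-of-information experiment on Tao's machine paradigm;
NOT a claim that NS blows up.

WHAT. Part 86 is re-read over part 88's sharp ladder. With part 83's dominating reals `D =
7/K⁴`, `U = 7/2 + k²/3 + 10⁻³` (`1 ≤ k ≤ K²`) and part 86's slip `S = (1.1 + k²/10)/K⁹`, the
sharp rung loss is `L = 242 log K/K¹⁰ + 37(7/K⁴ + ι + 4/K⁹)/K⁹`, `ι = (2k + 3)/(5K⁹)`. §258
`sharp_loss_numerics`: `0 ≤ L ≤ 42/K⁹` (`242 log K/K ≤ 41.95` from `log K/K ≤ log 16/16`; the cold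
term `≤ 444/K¹³ ≤ 0.0068/K⁹`); §258 `knob_misfire_ladder_sharp` is part 86 §250 with the clock
window `(N - 1)·L ≤ 0.144` and the pair window `(N - 1)(1.1 + k²/10)/K⁹ ≤ 0.0199`: from part 83
§241's anchor `r₁ > 2.8282`, for every `1 ≤ n ≤ N` a normal-form ignition `rₙ > 1.8282 + n`
with `P(rₙ) ≤ 10⁻⁴ + (n - 1)(1.1 + k²/10)/K⁹ ≤ 1/50`, `(n - 1)/K⁹ ≤ ã(rₙ) ≤ 0.1415`, `|d(rₙ)|
≤ 7/K⁴`. §259: every `N - 1 ≤ 3.428·10⁻³K⁹` satisfies the clock window (`sharp_window_explicit`,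
`3.428·10⁻³·42 ≤ 0.144`) and, for `k ≤ 6`, the pair window (`sharp_window_pair`, `4.7·3.428·10⁻³
≤ 0.0199`); so §259 `knob_dud_horizon_sharp` / `knob_ladder_no_output_sharp`: for `1 ≤ k ≤ 6`
and every `1 ≤ N ≤ 1 + 3.428·10⁻³K⁹` the member mis-fires `N` times and `ã ≤ 0.1415` on `[0,
1.8282 + N]` — an EXPLICIT, LOG-FREE dud horizon `×2.02` part 86's `1.694·10⁻³K⁹` and `×6.8`
part 83's `5.03·10⁻⁴K⁹` (`2.36·10⁸` rungs at `K = 16` against `1.16·10⁸` and `3.46·10⁷`).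
READING (SPEC-INPUT-bp1 §BO(4)(a)). The explicit window is uniform in `K ≥ 16` only because it
spends `log K/K ≤ log 16/16`; the true clock window `0.144/L ≈ 5.95·10⁻⁴K¹⁰/log K` outgrows
the pair window `0.0199K⁹/(1.1 + k²/10)`, which does not move: the clean dud horizon of §258 is
PAIR-LIMITED for `k ≥ 7` at every `K ≥ 16` (there `(1.1 + k²/10)·3.428·10⁻³ > 0.0199` already)
and for `k ≤ 6` from `K ≥ 138, 104, 72, 48, 33, 22` on (`k = 1, …, 6`). Past the pair window only
the √P-ledger of §BO(4)(b) can go (`(n - 1)U/K⁹ ≤ 0.1414 - √P₁`: `≈ 0.035K⁹` at `k = 1`, about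
`4×` short of part 72's forced ceiling `0.1415K⁹ + 1`). With part 87 the clock has stopped
being the binding constraint of the clean ladder except at small `K` and small `k`.
HONEST LIMITS. (i) `3.428·10⁻³K⁹` is not the true window at large `K` (not claimed); (ii)
existence per rung, no uniqueness, no gap law beyond `rₙ₊₁ ≥ rₙ + 1`; (iii) `k = 0` excluded by
part 64; (iv) the remaining clock charge `242 log K/K¹⁰` is itself bookkeeping (part 88 limits
(i)); (v) nothing about Navier–Stokes.
[cite: Tao2016AveragedNS, §5.5 Theorem 5.3, (5.5), (5.6), (b-eq), (c-eq), (d-eq), (ta-eq),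
(energy-con), (est)]
-/

noncomputable section

namespace Summit.NavierStokesRegularity.FluidComputer.GateBudget

open Real Set Filter Topology
open Literature.Analysis.FluidPDE.Tao2016AveragedNS

variable {K ε ρ : ℝ} {X : ℝ → Fin 5 → ℝ} {C : ℝ → ℝ}

/-! ## §258 Numerics of the sharp rung loss; the sharp misfire ladder -/

/-- §258 NUMERICS (`K ≥ 16`, `1 ≤ k ≤ K²`): the sharp rung loss at `D = 7/K⁴`, `L = 242 log
K/K¹⁰ + 37(7/K⁴ + (2k + 3)/(5K⁹) + 4/K⁹)/K⁹`, has `0 ≤ L ≤ 42/K⁹` (`log K/K ≤ log 16/16 ≤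
2.773/16`, so `242 log K/K¹⁰ ≤ 41.95/K⁹`; `(2k + 3)/(5K⁹) ≤ 1/K⁴`, `4/K⁹ ≤ 4/K⁴`, `444/K⁴ ≤
0.0068`). [folklore] -/
theorem sharp_loss_numerics (hK : 16 ≤ K) {k : ℝ} (hk1 : 1 ≤ k) (hkK : k ≤ K ^ 2) :
    0 ≤ 242 * log K / K ^ 10 + 37 * (7 / K ^ 4 + (2 * k + 3) / (5 * K ^ 9) + 4 / K ^ 9) / K ^ 9 ∧
      242 * log K / K ^ 10 + 37 * (7 / K ^ 4 + (2 * k + 3) / (5 * K ^ 9) + 4 / K ^ 9) / K ^ 9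
        ≤ 42 / K ^ 9 := by
  have hK0 : (0 : ℝ) < K := by linarith
  have hK1 : (1 : ℝ) ≤ K := by linarith
  have hk0 : 0 ≤ k := by linarith
  have hK4p : (0 : ℝ) < K ^ 4 := by positivity
  have hK9 : (0 : ℝ) < K ^ 9 := by positivity
  have hK10 : (0 : ℝ) < K ^ 10 := by positivity
  have h4 : (65536 : ℝ) ≤ K ^ 4 := by
    have := headline_pow_floor hK 4; norm_num at this; exact this
  -- the pulse term: `log K/K ≤ log 16/16`
  have he16 : exp 1 ≤ 16 := by have := Real.exp_one_lt_d9; linarith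
  have hmono := Real.log_div_self_antitoneOn (show (16 : ℝ) ∈ Set.Ici (exp 1) from he16)
    (show K ∈ Set.Ici (exp 1) from le_trans he16 hK) hK
  simp only at hmono
  have hlog16 : log 16 ≤ 2773 / 1000 := by
    have e : log (16 : ℝ) = 4 * log 2 := by
      rw [show (16 : ℝ) = 2 ^ 4 by norm_num, Real.log_pow]; norm_num
    rw [e]; linarith only [Real.log_two_lt_d9]
  have hl : log K ≤ 2773 / 16000 * K := by
    rw [div_le_iff₀ hK0] at hmono
    have := mul_le_mul_of_nonneg_right (div_le_div_of_nonneg_right hlog16 (by norm_num :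
      (0 : ℝ) ≤ 16)) hK0.le
    linarith only [hmono, this]
  have h1 : 242 * log K / K ^ 10 ≤ 4195 / 100 / K ^ 9 := by
    rw [div_le_div_iff₀ hK10 hK9]
    have := mul_le_mul_of_nonneg_right hl hK9.le
    have e : K * K ^ 9 = K ^ 10 := by ring
    nlinarith only [this, e, hK10]
  have hlogK : 0 ≤ log K := Real.log_nonneg (by linarith)
  have h1' : 0 ≤ 242 * log K / K ^ 10 := div_nonneg (mul_nonneg (by norm_num) hlogK) hK10.le
  -- the cold term: `≤ 444/K⁴/K⁹ ≤ (5/100)/K⁹`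
  have hι1 : (2 * k + 3) / (5 * K ^ 9) ≤ 1 / K ^ 4 := by
    rw [div_le_div_iff₀ (by positivity) hK4p]
    have p1 := mul_le_mul_of_nonneg_right hkK hK4p.le
    have p2 : K ^ 6 ≤ K ^ 9 := pow_le_pow_right₀ hK1 (by norm_num)
    have p3 : K ^ 4 ≤ K ^ 9 := pow_le_pow_right₀ hK1 (by norm_num)
    have e : K ^ 2 * K ^ 4 = K ^ 6 := by ring
    linarith only [p1, p2, p3, e]
  have h49 : (4 : ℝ) / K ^ 9 ≤ 4 / K ^ 4 :=
    div_le_div_of_nonneg_left (by norm_num) hK4p (pow_le_pow_right₀ hK1 (by norm_num))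
  have h2 : 37 * (7 / K ^ 4 + (2 * k + 3) / (5 * K ^ 9) + 4 / K ^ 9) / K ^ 9
      ≤ 5 / 100 / K ^ 9 := by
    refine div_le_div_of_nonneg_right ?_ hK9.le
    have h444 : (444 : ℝ) / K ^ 4 ≤ 444 / 65536 :=
      div_le_div_of_nonneg_left (by norm_num) (by norm_num) h4
    have e : (444 : ℝ) / K ^ 4 = 37 * (7 / K ^ 4 + 1 / K ^ 4 + 4 / K ^ 4) := by ring
    linarith only [hι1, h49, h444, e]
  have h2' : 0 ≤ 37 * (7 / K ^ 4 + (2 * k + 3) / (5 * K ^ 9) + 4 / K ^ 9) / K ^ 9 := by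
    positivity
  have e : (42 : ℝ) / K ^ 9 = 4195 / 100 / K ^ 9 + 5 / 100 / K ^ 9 := by ring
  exact ⟨by linarith only [h1', h2'], by linarith only [h1, h2, e]⟩

/-- §258 **THE SHARP MISFIRE LADDER.** Headline member from `delayInit` with a trigger primitive
`C`, `K ≥ 16`, lattice window, winding `1 ≤ k ≤ K²`, sharp rung loss `L = 242 log K/K¹⁰ + 37(7/K⁴
+ (2k + 3)/(5K⁹) + 4/K⁹)/K⁹`. For every `N` inside the clock window `(N - 1)·L ≤ 0.144` and the
pair window `(N - 1)·(1.1 + k²/10)/K⁹ ≤ 0.0199`, and every `1 ≤ n ≤ N`: an ignition `rₙ > 1.8282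
+ n` in normal form, `b(rₙ) = θₙε`, `5/4 ≤ θₙ ≤ 29/20`, `c(rₙ) = ρ²/K⁹`, with `P(rₙ) ≤ 10⁻⁴ +
(n - 1)(1.1 + k²/10)/K⁹`, `P(rₙ) ≤ 1/50`, `(n - 1)/K⁹ ≤ ã(rₙ) ≤ 0.1415`, `|d(rₙ)| ≤ 7/K⁴`.
[derived: part 83 §241/§242, part 86 §250, part 88 §257] -/
theorem knob_misfire_ladder_sharp
    (hX : ∀ t, HasDerivAt X (RotorKnob.rotorCircuit K (K ^ 10) ε ρ (X t)) t)
    (h0 : X 0 = delayInit) (hC : ∀ t, HasDerivAt C (X t 2) t) (hK : 16 ≤ K)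
    (hε : 0 < ε) (hεK : ε ^ 2 ≤ 1 / (6 * K ^ 20)) (hρ : 0 < ρ)
    (hlo : 200 * ε / K ^ 20 ≤ ρ ^ 2) (hhi : K ^ 10 * ρ ^ 2 ≤ 2 * ε) (k : ℕ)
    (hk : ε = k * K ^ 10 * ρ ^ 2) (hkK : (k : ℝ) ≤ K ^ 2) (N : ℕ)
    (hNθ : ((N : ℝ) - 1) * (242 * log K / K ^ 10
      + 37 * (7 / K ^ 4 + (2 * k + 3) / (5 * K ^ 9) + 4 / K ^ 9) / K ^ 9) ≤ 144 / 1000)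
    (hNP : ((N : ℝ) - 1) * ((11 / 10 + k ^ 2 / 10) / K ^ 9) ≤ 199 / 10000) :
    ∀ n : ℕ, 1 ≤ n → n ≤ N → ∃ r θ : ℝ, 18282 / 10000 + n < r ∧ X r 1 = θ * ε ∧
      5 / 4 ≤ θ ∧ θ ≤ 29 / 20 ∧ X r 2 = ρ ^ 2 / K ^ 9 ∧
      X r 3 ^ 2 + X r 4 ^ 2 ≤ 1 / 10000 + ((n : ℝ) - 1) * ((11 / 10 + k ^ 2 / 10) / K ^ 9) ∧
      X r 3 ^ 2 + X r 4 ^ 2 ≤ 1 / 50 ∧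
      ((n : ℝ) - 1) / K ^ 9 ≤ X r 4 ∧ X r 4 ≤ 1415 / 10000 ∧ |X r 3| ≤ 7 / K ^ 4 := by
  obtain ⟨r₁, θ₁, hr1, hb1, hθlo, hθhi, hc1, he0, hP1, hd1, hk1⟩ :=
    knob_ladder_anchor_member hX h0 hC hK hε hεK hρ hlo hhi k hk
  obtain ⟨hD, hU, -, hD0sq, hres⟩ := two_sided_numerics hK hk1 hkK
  have hS := clock_slip_numerics hK hk1 hkK
  have hθ₀lo : 5 / 4 + ((N : ℝ) - 1) * (242 * log K / K ^ 10
        + 37 * (7 / K ^ 4 + (2 * k + 3) / (5 * K ^ 9) + 4 / K ^ 9) / K ^ 9) ≤ θ₁ := by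
    linarith only [hNθ, hθlo]
  have hNP' : (k * π / (49 / 100 * K ^ 10 - 1) + 2 / K ^ 10 + 245 / K ^ 8) ^ 2
      + (3 * (k * π / ((25 / 16 - 1 / 10 ^ 6) * K ^ 10 - 1) + 1 / K ^ 19
        + 310 * log K / K ^ 9) / 10 + 6 / K ^ 9)
      + ((N : ℝ) - 1) * ((11 / 10 + k ^ 2 / 10) / K ^ 9) ≤ 1 / 50 := by
    linarith only [hres, hNP]
  intro n hn hnN
  obtain ⟨r, θ, hr, hb, hθ1, hθ2, hc, hP, hP50, hA, ha, hd⟩ := knob_ladder_sharp hX h0 hC hK hε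
    hεK hρ hlo hhi k hk (le_of_lt (by linarith only [hr1])) hb1 hc1 hP1 hθ₀lo
    (by linarith only [hθhi]) (by linarith only [hNθ]) le_rfl he0 hd1 hD hU hS le_rfl hNP' n hn
    hnN
  refine ⟨r, θ, by linarith only [hr, hr1], hb, hθ1, hθ2, hc, by linarith only [hP, hD0sq],
    hP50, by simpa using hA, ha, hd⟩

/-! ## §259 Small winding: the explicit sharp window is the horizon; no output while it lasts -/

/-- §259 THE EXPLICIT WINDOW ⊂ PAIR WINDOW for `k ≤ 6` (`K ≥ 16`, any real `y ≤ 3.428·10⁻³K⁹`):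
`y·(1.1 + k²/10)/K⁹ ≤ 0.0199` (`4.7·3.428·10⁻³ = 0.01611`). [folklore] -/
theorem sharp_window_pair (hK : 16 ≤ K) {k y : ℝ} (hk0 : 0 ≤ k) (hk : k ≤ 6)
    (hy : y ≤ 3428 / 10 ^ 6 * K ^ 9) :
    y * ((11 / 10 + k ^ 2 / 10) / K ^ 9) ≤ 199 / 10000 := by
  have hK0 : (0 : ℝ) < K := by linarith
  have hK9 : (0 : ℝ) < K ^ 9 := by positivity
  have hs0 : 0 ≤ (11 / 10 + k ^ 2 / 10) / K ^ 9 := by positivity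
  have hs : (11 / 10 + k ^ 2 / 10) / K ^ 9 ≤ (47 / 10) / K ^ 9 :=
    div_le_div_of_nonneg_right (by nlinarith only [hk, hk0]) hK9.le
  have h := mul_le_mul hy hs hs0 (by positivity)
  have e : 3428 / 10 ^ 6 * K ^ 9 * (47 / 10 / K ^ 9) = 161116 / 10 ^ 7 := by
    field_simp; norm_num
  linarith only [h, e]

/-- §259 THE EXPLICIT SHARP WINDOW (`K ≥ 16`, `1 ≤ k ≤ K²`): `L ≤ 42/K⁹` (§258), so `y ≤
3.428·10⁻³K⁹` ⇒ `y·L ≤ 0.144` (any real `y`; `3.428·10⁻³·42 = 0.143976`). [folklore] -/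
theorem sharp_window_explicit (hK : 16 ≤ K) {k y : ℝ} (hk1 : 1 ≤ k) (hkK : k ≤ K ^ 2)
    (hy : y ≤ 3428 / 10 ^ 6 * K ^ 9) :
    y * (242 * log K / K ^ 10 + 37 * (7 / K ^ 4 + (2 * k + 3) / (5 * K ^ 9) + 4 / K ^ 9) / K ^ 9)
      ≤ 144 / 1000 := by
  have hK0 : (0 : ℝ) < K := by linarith
  have hK9 : (0 : ℝ) < K ^ 9 := by positivity
  obtain ⟨hl0, hl42⟩ := sharp_loss_numerics hK hk1 hkK
  have h2 := mul_le_mul hy hl42 hl0 (by positivity)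
  have e : 3428 / 10 ^ 6 * K ^ 9 * (42 / K ^ 9) = 143976 / 10 ^ 6 := by
    field_simp; norm_num
  linarith only [h2, e]

/-- §259 **THE SHARP DUD HORIZON, SMALL WINDING, EXPLICIT** (`1 ≤ k ≤ 6`, `K ≥ 16`): for every `N`
with `N - 1 ≤ 3.428·10⁻³K⁹` — log-free, `×2.02` part 86's `1.694·10⁻³K⁹`, `×6.8` part 83's
`5.03·10⁻⁴K⁹` — §258's conclusion: `N` clean mis-fires `rₙ > 1.8282 + n`, `P(rₙ) ≤ 10⁻⁴ + (n -
1)(1.1 + k²/10)/K⁹ ≤ 1/50`, `(n - 1)/K⁹ ≤ ã(rₙ) ≤ 0.1415`, `|d(rₙ)| ≤ 7/K⁴`. [derived: §258,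
§259] -/
theorem knob_dud_horizon_sharp
    (hX : ∀ t, HasDerivAt X (RotorKnob.rotorCircuit K (K ^ 10) ε ρ (X t)) t)
    (h0 : X 0 = delayInit) (hC : ∀ t, HasDerivAt C (X t 2) t) (hK : 16 ≤ K)
    (hε : 0 < ε) (hεK : ε ^ 2 ≤ 1 / (6 * K ^ 20)) (hρ : 0 < ρ)
    (hlo : 200 * ε / K ^ 20 ≤ ρ ^ 2) (hhi : K ^ 10 * ρ ^ 2 ≤ 2 * ε) (k : ℕ)
    (hk : ε = k * K ^ 10 * ρ ^ 2) (hk6 : k ≤ 6) (N : ℕ)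
    (hN : (N : ℝ) - 1 ≤ 3428 / 10 ^ 6 * K ^ 9) :
    ∀ n : ℕ, 1 ≤ n → n ≤ N → ∃ r θ : ℝ, 18282 / 10000 + n < r ∧ X r 1 = θ * ε ∧
      5 / 4 ≤ θ ∧ θ ≤ 29 / 20 ∧ X r 2 = ρ ^ 2 / K ^ 9 ∧
      X r 3 ^ 2 + X r 4 ^ 2 ≤ 1 / 10000 + ((n : ℝ) - 1) * ((11 / 10 + k ^ 2 / 10) / K ^ 9) ∧
      X r 3 ^ 2 + X r 4 ^ 2 ≤ 1 / 50 ∧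
      ((n : ℝ) - 1) / K ^ 9 ≤ X r 4 ∧ X r 4 ≤ 1415 / 10000 ∧ |X r 3| ≤ 7 / K ^ 4 := by
  have hK0 : (0 : ℝ) < K := by linarith
  have hk6' : (k : ℝ) ≤ 6 := by exact_mod_cast hk6
  have hkK : (k : ℝ) ≤ K ^ 2 := by nlinarith only [hk6', hK]
  obtain ⟨hk1, -, -, -, -, -⟩ := rung_numerics hK hε hρ hlo k hk
  exact knob_misfire_ladder_sharp hX h0 hC hK hε hεK hρ hlo hhi k hk hkK N
    (sharp_window_explicit hK hk1 hkK hN) (sharp_window_pair hK (Nat.cast_nonneg k) hk6' hN)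

/-- §259 **NO OUTPUT UP TO THE EXPLICIT SHARP HORIZON** (`1 ≤ k ≤ 6`, `K ≥ 16`, `1 ≤ N ≤ 1 +
3.428·10⁻³K⁹`): `ã(t) ≤ 0.1415` for every `t ∈ [0, 1.8282 + N]` — the member has not fired (`ã`
is non-decreasing and `≤ 0.1415` at the `N`-th ignition `r_N > 1.8282 + N`); at `K = 16` that is
`2.36·10⁸` time units. [derived: §259, RotorKnob.rotorCircuit_output_monotone] -/
theorem knob_ladder_no_output_sharp
    (hX : ∀ t, HasDerivAt X (RotorKnob.rotorCircuit K (K ^ 10) ε ρ (X t)) t)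
    (h0 : X 0 = delayInit) (hC : ∀ t, HasDerivAt C (X t 2) t) (hK : 16 ≤ K)
    (hε : 0 < ε) (hεK : ε ^ 2 ≤ 1 / (6 * K ^ 20)) (hρ : 0 < ρ)
    (hlo : 200 * ε / K ^ 20 ≤ ρ ^ 2) (hhi : K ^ 10 * ρ ^ 2 ≤ 2 * ε) (k : ℕ)
    (hk : ε = k * K ^ 10 * ρ ^ 2) (hk6 : k ≤ 6) (N : ℕ) (hN1 : 1 ≤ N)
    (hN : (N : ℝ) - 1 ≤ 3428 / 10 ^ 6 * K ^ 9) :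
    ∀ t ∈ Icc (0 : ℝ) (18282 / 10000 + N), X t 4 ≤ 1415 / 10000 := by
  have hK0 : (0 : ℝ) < K := by linarith
  obtain ⟨r, θ, hr, -, -, -, -, -, -, -, ha, -⟩ :=
    knob_dud_horizon_sharp hX h0 hC hK hε hεK hρ hlo hhi k hk hk6 N hN N hN1 le_rfl
  intro t ht
  exact (RotorKnob.rotorCircuit_output_monotone hK0.le hX (by linarith only [ht.2, hr])).trans ha

end Summit.NavierStokesRegularity.FluidComputer.GateBudget

end
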